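import Summits.QuantumFields.BalabanUV.T4Continuum.Support.NE7EffectiveFormLevelMonotone
import Summits.QuantumFields.BalabanUV.T4Continuum.Support.NE7EffectiveFormCurlEquivalence
import HarnessLib

/-!
# NE7EffectiveFormLevelLimitFlat — THE INFINITE-LEVEL LIMIT OF BAŁABAN'S FLAT-BACKGROUND EFFECTIVE QUADRATIC FORM EXISTS:
# `⟨v, Δ_{j+1} v⟩ ↑ ⟨v, Δ_∞ v⟩` as `j → ∞`, for every coarse direction `v`, every volume `N`, every `U(n)`, with `Σ_P ‖curl_1 ṽ‖² ≤ ⟨v, Δ_∞ v⟩ ≤ homC 4 · Σ_P ‖curl_1 ṽ‖²`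

Lineage `b2b-balaban-t4-ne7-p1` (CRUX PROVER NE7 #1 = OWNER of BINDER row NE7), generation 116.  With the flat theory of the variational `Δ_{j+1}` now TWO-SIDED and uniform
in the level (floor ✓ `NE7EffectiveFormCoarseCurlAllLevels`, this road; ceiling ✓ `NE7EffectiveFormCurlEquivalence.effectiveForm_le_curl_flat_allLevels`, row NE7b g160, junction
service) and MONOTONE in the level (✓ `NE7EffectiveFormLevelMonotone.effectiveForm_mono_level_flat`: a `(j+2)`-step competitor averages to a `(j+1)`-step one of no larger energy),
the sequence `j ↦ D²(minAct 4 (sfClass 4 L N ε) L N (j+1) ∘ chart_1)(0)[v,v]` is non-decreasing and bounded, hence CONVERGES (monotone convergence) — the quadratic part of the effective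
action at the flat background has a limit as the number of renormalisation steps tends to infinity, with the SAME two-sided Maxwell bounds:
**`effectiveForm_tendsto_level_flat`**: `∃ ε₀ > 0, ∀ 0 < ε ≤ ε₀, ∀ N ≥ 1, ∀ v ∈ skewSub 4 n N, ∃ q, Tendsto (j ↦ D²m_{j+1}(0)[v,v]) atTop (𝓝 q) ∧ (∀ j, D²m_{j+1}(0)[v,v] ≤ q) ∧
Σ_{P∈perWin 4 N} nhsNormSq(curl_1 ṽ P) ≤ q ∧ q ≤ homC 4 · Σ_P nhsNormSq(curl_1 ṽ P)` (`q = sup_j`), and **`effectiveForm_levelLimit_eq_zero_iff`**: the limit vanishes iff `ṽ` is closed on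
the window (iff, by ✓ `NE7EffectiveFormKernelFlatCharacterisation`, `v` is a linearised gauge direction plus a constant).  [folklore]; 0 def, 0 sorry.
HONEST FRAMING: flat datum; OUR minimisers (B11 (8) with `sfClass`); a statement about the `j → ∞` behaviour of a FIXED-coarse-lattice quadratic form, NOT a continuum limit of the
theory; nothing of Bałaban's asserted; NOT NE7 as a spine node; spine 0∕9; NOT infinite volume, NOT mass gap, NOT BetaPertH, NOT Clay.
-/

set_option autoImplicit false

open scoped BigOperators Matrix Matrix.Norms.L2Operator Topology
open NormedSpace Finset Filter

namespace Summit.QuantumFields.BalabanUV.T4Continuum.NE7EffectiveFormLevelLimitFlat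

open Literature.MathematicalPhysics.QuantumFieldTheory.Balaban1983to89
open B7Prop1Explicit B7Prop2Explicit
open T4AveragingDeficitWall (curl)
open AveragingDeficitTorusChart (TDir chart chartDir)
open AveragingDeficitTwoLevelPrep (skewSub)
open MinimalActionLevels (perWin)
open MinimalActionSandwich (minAct)
open MinimalActionRate (sfClass)
open MinimalActionWitness (flatCfg)
open MatrixNorms (nhsNormSq nhsNormSq_nonneg)
open NE3LandauOrbit (eq_zero_of_nhsNormSq_eq_zero)
open NE7EffectiveFormLevelMonotone (effectiveForm_mono_level_flat)
open NE7EffectiveFormCurlEquivalence (effectiveForm_curl_two_sided_flat_allLevels)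

noncomputable section

variable {n : Type} [Fintype n] [DecidableEq n]

/-- **THE INFINITE-LEVEL LIMIT OF THE FLAT EFFECTIVE FORM EXISTS, WITH THE TWO-SIDED MAXWELL BOUNDS** (`d = 4`, every `U(n)`, `L ≥ 2`): for `0 < ε ≤ ε₀`, `N ≥ 1` and every
`v ∈ skewSub 4 n N` there is `q` (the supremum over the levels) with `D²m_{j+1}(0)[v,v] → q` as `j → ∞`, `D²m_{j+1}(0)[v,v] ≤ q` for every `j`, and
`Σ_P nhsNormSq(curl_1 ṽ P) ≤ q ≤ homC 4 · Σ_P nhsNormSq(curl_1 ṽ P)`. [folklore] -/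
theorem effectiveForm_tendsto_level_flat [Nonempty n] {L : ℕ} [NeZero L] (hL : 2 ≤ L) :
    ∃ ε₀ : ℝ, 0 < ε₀ ∧ ∀ ε : ℝ, 0 < ε → ε ≤ ε₀ → ∀ (N : ℕ) [NeZero N], 1 ≤ N → ∀ v : ↥(skewSub 4 n N), ∃ q : ℝ,
      Tendsto (fun j : ℕ => fderiv ℝ (fderiv ℝ (fun y : ↥(skewSub 4 n N) => minAct 4 (sfClass 4 L N ε) L N (j + 1)
          (chart (ContinuousLinearMap.id ℝ (Matrix n n ℂ)) N (flatCfg : Site 4 → Fin 4 → (Matrix n n ℂ)ˣ) (y : TDir 4 n N)))) 0 v v) atTop (𝓝 q) ∧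
      (∀ j : ℕ, fderiv ℝ (fderiv ℝ (fun y : ↥(skewSub 4 n N) => minAct 4 (sfClass 4 L N ε) L N (j + 1)
          (chart (ContinuousLinearMap.id ℝ (Matrix n n ℂ)) N (flatCfg : Site 4 → Fin 4 → (Matrix n n ℂ)ˣ) (y : TDir 4 n N)))) 0 v v ≤ q) ∧
      ∑ P ∈ perWin 4 N, nhsNormSq (curl (flatCfg : Site 4 → Fin 4 → (Matrix n n ℂ)ˣ) (chartDir (ContinuousLinearMap.id ℝ (Matrix n n ℂ)) N (v : TDir 4 n N)) P) ≤ q ∧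
      q ≤ 2 * (2304 * 4 ^ 4 + 4 * (4 : ℝ) * (24 * (8 : ℝ) ^ 3) ^ 2 * ((4 : ℝ) * 2 ^ 16))
          * ∑ P ∈ perWin 4 N, nhsNormSq (curl (flatCfg : Site 4 → Fin 4 → (Matrix n n ℂ)ˣ) (chartDir (ContinuousLinearMap.id ℝ (Matrix n n ℂ)) N (v : TDir 4 n N)) P) := by
  obtain ⟨ε₁, hε₁, H₁⟩ := effectiveForm_mono_level_flat (n := n) hL
  obtain ⟨ε₂, hε₂, H₂⟩ := effectiveForm_curl_two_sided_flat_allLevels (n := n) hL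
  refine ⟨min ε₁ ε₂, lt_min hε₁ hε₂, fun ε hε hεle N _ hN v => ?_⟩
  have hε1 : ε ≤ ε₁ := hεle.trans (min_le_left _ _)
  have hε2 : ε ≤ ε₂ := hεle.trans (min_le_right _ _)
  set a : ℕ → ℝ := fun j : ℕ => fderiv ℝ (fderiv ℝ (fun y : ↥(skewSub 4 n N) => minAct 4 (sfClass 4 L N ε) L N (j + 1)
      (chart (ContinuousLinearMap.id ℝ (Matrix n n ℂ)) N (flatCfg : Site 4 → Fin 4 → (Matrix n n ℂ)ˣ) (y : TDir 4 n N)))) 0 v v with ha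
  set c : ℝ := ∑ P ∈ perWin 4 N, nhsNormSq (curl (flatCfg : Site 4 → Fin 4 → (Matrix n n ℂ)ˣ)
      (chartDir (ContinuousLinearMap.id ℝ (Matrix n n ℂ)) N (v : TDir 4 n N)) P) with hc
  set C : ℝ := 2 * (2304 * 4 ^ 4 + 4 * (4 : ℝ) * (24 * (8 : ℝ) ^ 3) ^ 2 * ((4 : ℝ) * 2 ^ 16)) with hC
  have hmono : Monotone a := monotone_nat_of_le_succ fun j => H₁ ε hε hε1 N hN j v
  have hup : ∀ j, a j ≤ C * c := fun j => (H₂ ε hε hε2 N hN j v).2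
  have hlow : c ≤ a 0 := (H₂ ε hε hε2 N hN 0 v).1
  have hbdd : BddAbove (Set.range a) := ⟨C * c, by rintro _ ⟨j, rfl⟩; exact hup j⟩
  refine ⟨⨆ j, a j, tendsto_atTop_ciSup hmono hbdd, fun j => le_ciSup hbdd j, hlow.trans (le_ciSup hbdd 0), ciSup_le hup⟩

/-- **THE LIMIT VANISHES EXACTLY ON THE CLOSED DIRECTIONS**: with `q` as above (any limit of the sequence), `q = 0` iff `curl_1 ṽ = 0` on the window. [folklore] -/
theorem effectiveForm_levelLimit_eq_zero_iff [Nonempty n] {L : ℕ} [NeZero L] (hL : 2 ≤ L) :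
    ∃ ε₀ : ℝ, 0 < ε₀ ∧ ∀ ε : ℝ, 0 < ε → ε ≤ ε₀ → ∀ (N : ℕ) [NeZero N], 1 ≤ N → ∀ (v : ↥(skewSub 4 n N)) (q : ℝ),
      Tendsto (fun j : ℕ => fderiv ℝ (fderiv ℝ (fun y : ↥(skewSub 4 n N) => minAct 4 (sfClass 4 L N ε) L N (j + 1)
          (chart (ContinuousLinearMap.id ℝ (Matrix n n ℂ)) N (flatCfg : Site 4 → Fin 4 → (Matrix n n ℂ)ˣ) (y : TDir 4 n N)))) 0 v v) atTop (𝓝 q) →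
      (q = 0 ↔ ∀ P ∈ perWin 4 N, curl (flatCfg : Site 4 → Fin 4 → (Matrix n n ℂ)ˣ) (chartDir (ContinuousLinearMap.id ℝ (Matrix n n ℂ)) N (v : TDir 4 n N)) P = 0) := by
  obtain ⟨ε₀, hε₀, H⟩ := effectiveForm_tendsto_level_flat (n := n) hL
  refine ⟨ε₀, hε₀, fun ε hε hεle N _ hN v q hq => ?_⟩
  obtain ⟨q', hq', -, hlow, hup⟩ := H ε hε hεle N hN v
  have hqq : q = q' := tendsto_nhds_unique hq hq'
  subst hqq
  have hc0 : 0 ≤ ∑ P ∈ perWin 4 N, nhsNormSq (curl (flatCfg : Site 4 → Fin 4 → (Matrix n n ℂ)ˣ)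
      (chartDir (ContinuousLinearMap.id ℝ (Matrix n n ℂ)) N (v : TDir 4 n N)) P) := Finset.sum_nonneg fun P _ => nhsNormSq_nonneg _
  constructor
  · intro hq0 P hP
    rw [hq0] at hlow
    have hsum : ∑ P ∈ perWin 4 N, nhsNormSq (curl (flatCfg : Site 4 → Fin 4 → (Matrix n n ℂ)ˣ)
        (chartDir (ContinuousLinearMap.id ℝ (Matrix n n ℂ)) N (v : TDir 4 n N)) P) = 0 := le_antisymm hlow hc0
    exact eq_zero_of_nhsNormSq_eq_zero ((Finset.sum_eq_zero_iff_of_nonneg fun P _ => nhsNormSq_nonneg _).mp hsum P hP)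
  · intro hcurl
    have hsum : ∑ P ∈ perWin 4 N, nhsNormSq (curl (flatCfg : Site 4 → Fin 4 → (Matrix n n ℂ)ˣ)
        (chartDir (ContinuousLinearMap.id ℝ (Matrix n n ℂ)) N (v : TDir 4 n N)) P) = 0 :=
      Finset.sum_eq_zero fun P hP => by rw [hcurl P hP]; simp [nhsNormSq]
    rw [hsum, mul_zero] at hup
    rw [hsum] at hlow
    exact le_antisymm hup hlow

end

end Summit.QuantumFields.BalabanUV.T4Continuum.NE7EffectiveFormLevelLimitFlat
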